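import Summits.Ventures.LatticeQCDFlow.Scaling.StartStateDomination
import Summits.Ventures.LatticeQCDFlow.Scaling.TaggedHubLumping
import Summits.Ventures.LatticeQCDFlow.Scaling.MinNetworkMonotone

/-!
HONEST FRAMING: exact (Metropolis-corrected) sampling algorithms for lattice gauge theory; figures
of merit are autocorrelation/cost numbers at stated couplings and volumes; no continuum-physics
claim.

# TaggedDomination — CONJECTURE M OF MEMO-gen37 PROVED: FOR THE TWO TAGGED HUB CHAINS OF AN ADJACENT PAIR (`X` TAGGING THE MORE PERSISTENT EXTRA PARTICLE) THE TAIL LAWS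
# SATISFY `ỹ_z(w) ≤ x̃_z(w)` FOR EVERY ORDINARY CONTENT `w` FROM THE COMMON HUB `z`, AND `ỹ_★(w) ≤ x̃_★(w)` FROM ★, AT EVERY SWAP ODDS (lean-2 GEN-38, ours)

Venture-side (OURS).  Cell `lqcd-flow` (pub-lqcd), unit `pub-lqcd-lean-2-g38`, 2026-08-30.  Chapter W (item 1 (i) at finite swap odds), file 26 — the bridge from the network comparison
theorem (file 25 `minNet_antitone`) to the two DOMINATION hypotheses `hdom`, `hDstar` of file 23 `finiteOdds_domination_worstTvDist_le`.  For a tagged hub chain `P` (ordinary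
composition `N_C`, tag `s`, rates of file 14) with reversing masses `m(v) = N_C(v)/W_v`, `m(★) = 1/W_s` (file 20): the conductances are `m(t)P(t,u) = N_uN_t·min(ρ_u,ρ_t)/K`,
`ρ = 1/W` the depth, `N` the class sizes with `N(★) = 1` (`tagged_conductance_eq`), so a column resolvent `f = δ_{t₀} + σPf` solves the network system of file 24 on the present
states with `κ = 1−σ`, `β = σ/K` and source `m(t₀)δ_{t₀}` (`tagged_column_minNet`).  The two chains of an adjacent pair (`X` tags `a`, `Y` tags `b`, `W_b ≤ W_a`) differ only in the
depth of ★ (`1/W_a ≤ 1/W_b`), so file 25 gives `f_Y/m_Y(t₀) ≤ f_X/m_X(t₀)` on the present states (`tagged_column_domination`); file 20's `rowResolvent_to_column` turns the row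
tail laws into column resolvents, whence **`tagged_hub_domination`** (`ỹ_z(w) ≤ x̃_z(w)`, all ordinary `w`; the instance `w = z` is file 20) and **`tagged_star_domination`**
(`ỹ_★(w) ≤ x̃_★(w)`, all ordinary `w`); absent contents carry no tail mass (`tagged_tail_absent`, `tagged_star_tail_absent`), `σ = 0` is one step.  Hypothesis-equations, no definitions.

## What is proved

* `tagged_conductance_eq`, `tagged_column_minNet`, **`tagged_column_domination`**, `tagged_star_tail_absent`, **`tagged_hub_domination`**, **`tagged_star_domination`**.

Reading (no numerics implied): raising the impersistence of one particle lowers the discounted hub occupation of every other particle, from every start — the labelled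
Conjecture M of MEMO-gen37 (its per-horizon cumulative form is not claimed).  Literature grade (cell rule): OWN, elementary; nothing cited as a fact; no new bib keys.
-/

open Finset

namespace Summit.Ventures.LatticeQCDFlow.Scaling

section TaggedNet
variable {S : Type*} [Fintype S] [DecidableEq S]
variable {W : S → ℝ} {acc : S → S → ℝ} {K : ℕ} {NC : S → ℕ} {s : S} {P : Option S → Option S → ℝ}

omit [Fintype S] [DecidableEq S] in
/-- **The conductances of the tagged hub chain:** `m(t)P(t,u) = N_uN_t·min(ρ_u,ρ_t)/K` for `t ≠ u` (`m(v) = N_C(v)/W_v`, `m(★) = 1/W_s`; `N(v) = N_C(v)`, `N(★) = 1`; `ρ(v) = 1/W_v`,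
`ρ(★) = 1/W_s`). [ours] -/
theorem tagged_conductance_eq (hW : ∀ v, 0 < W v) (hacc : ∀ h v, acc h v = min 1 (W h / W v))
    (hPoff : ∀ h v, h ≠ v → P (some h) (some v) = if NC h = 0 then 0 else (NC v : ℝ) / K * acc h v)
    (hPin : ∀ h, P (some h) none = if NC h = 0 then 0 else acc h s / K)
    (hPout : ∀ v, P none (some v) = (NC v : ℝ) / K * acc s v)
    {m N ρ : Option S → ℝ} (hms : ∀ v, m (some v) = (NC v : ℝ) / W v) (hmn : m none = 1 / W s)
    (hNs : ∀ v, N (some v) = (NC v : ℝ)) (hNn : N none = 1) (hρs : ∀ v, ρ (some v) = 1 / W v) (hρn : ρ none = 1 / W s) :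
    ∀ t u, t ≠ u → m t * P t u = N u * N t * min (ρ u) (ρ t) / K := by
  have hmin : ∀ h v, acc h v / W h = min (1 / W v) (1 / W h) := by
    intro h v; rw [hacc]
    have hWh := hW h; have hWv := hW v
    rcases le_total (W h) (W v) with hle | hle
    · rw [min_eq_right ((div_le_one hWv).mpr hle), min_eq_left (one_div_le_one_div_of_le hWh hle)]; field_simp
    · rw [min_eq_left ((one_le_div hWv).mpr hle), min_eq_right (one_div_le_one_div_of_le hWv hle)]
  intro t u htu
  rcases t with _ | h <;> rcases u with _ | v
  · exact absurd rfl htu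
  · rw [hmn, hPout, hNs, hNn, hρs, hρn, ← hmin s v]; ring
  · rw [hms, hPin, hNn, hNs, hρn, hρs]
    by_cases hh : NC h = 0
    · rw [if_pos hh, hh]; simp
    · rw [if_neg hh, ← hmin h s]; ring
  · have hhv : h ≠ v := fun e => htu (by rw [e])
    rw [hms, hPoff h v hhv, hNs, hNs, hρs, hρs]
    by_cases hh : NC h = 0
    · rw [if_pos hh, hh]; simp
    · rw [if_neg hh, ← hmin h v]; ring

/-- **A column resolvent solves the network system:** if `f = δ_{t₀} + σPf` for the tagged hub chain, then on the set `A` of present states (`N ≠ 0`) `f` solves the system of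
file 24 with `κ = 1−σ`, `β = σ/K`, weights `N`, depths `ρ`, and source `m(t₀)δ_{t₀}`. [ours] -/
theorem tagged_column_minNet (hW : ∀ v, 0 < W v) (hacc : ∀ h v, acc h v = min 1 (W h / W v))
    (hPoff : ∀ h v, h ≠ v → P (some h) (some v) = if NC h = 0 then 0 else (NC v : ℝ) / K * acc h v)
    (hPin : ∀ h, P (some h) none = if NC h = 0 then 0 else acc h s / K)
    (hPdiag : ∀ h, P (some h) (some h) = 1 - (∑ v ∈ univ.erase h, P (some h) (some v) + P (some h) none))
    (hPout : ∀ v, P none (some v) = (NC v : ℝ) / K * acc s v) (hPstay : P none none = 1 - ∑ v, P none (some v)) (hK : 1 ≤ K)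
    {m N ρ : Option S → ℝ} (hms : ∀ v, m (some v) = (NC v : ℝ) / W v) (hmn : m none = 1 / W s)
    (hNs : ∀ v, N (some v) = (NC v : ℝ)) (hNn : N none = 1) (hρs : ∀ v, ρ (some v) = 1 / W v) (hρn : ρ none = 1 / W s)
    {σ : ℝ} {t₀ : Option S} {f : Option S → ℝ} (hf : ∀ t, f t = (if t = t₀ then 1 else 0) + σ * ∑ k, P t k * f k)
    {L : Finset (Option S) → (Option S → ℝ) → (Option S → ℝ) → Option S → ℝ}
    (hL : ∀ A ρ φ v, L A ρ φ v = (1 - σ) * (N v * ρ v) * φ v + σ / K * ∑ u ∈ A.erase v, N u * N v * min (ρ u) (ρ v) * (φ v - φ u))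
    {A : Finset (Option S)} (hA : ∀ t, t ∈ A ↔ N t ≠ 0) :
    ∀ t ∈ A, L A ρ f t = if t = t₀ then m t₀ else 0 := by
  have hcond := tagged_conductance_eq hW hacc hPoff hPin hPout hms hmn hNs hNn hρs hρn
  have hP1 := tagged_rowsum (P := P) hPdiag hPstay
  have hK0 : (K : ℝ) ≠ 0 := by have : (1 : ℝ) ≤ K := by exact_mod_cast hK
                               linarith
  have hmN : ∀ t, m t = N t * ρ t := by
    intro t; rcases t with _ | v
    · rw [hmn, hNn, hρn]; ring
    · rw [hms, hNs, hρs]; ring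
  intro t _
  rw [hL]
  -- the edge sum, extended to all `u ≠ t` (absent nodes have `N = 0`) and written with the conductances
  have e1 : ∑ u ∈ A.erase t, N u * N t * min (ρ u) (ρ t) * (f t - f u) = ∑ u ∈ univ.erase t, N u * N t * min (ρ u) (ρ t) * (f t - f u) := by
    refine sum_subset (erase_subset_erase t (subset_univ A)) fun u hu hnu => ?_
    have hNu : N u = 0 := by
      by_contra h
      exact hnu (mem_erase.mpr ⟨ne_of_mem_erase hu, (hA u).mpr h⟩)
    rw [hNu]; ring
  have e2 : ∑ u ∈ univ.erase t, N u * N t * min (ρ u) (ρ t) * (f t - f u) = (K : ℝ) * ∑ u ∈ univ.erase t, m t * P t u * (f t - f u) := by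
    rw [mul_sum]
    refine sum_congr rfl fun u hu => ?_
    rw [hcond t u (ne_of_mem_erase hu).symm]
    field_simp
  have e3 : ∑ u ∈ univ.erase t, m t * P t u * (f t - f u) = m t * f t - m t * ∑ u, P t u * f u := by
    rw [sum_erase univ (f := fun u => m t * P t u * (f t - f u)) (a := t) (by simp only [sub_self, mul_zero])]
    have : ∑ u, m t * P t u * (f t - f u) = m t * f t * ∑ u, P t u - m t * ∑ u, P t u * f u := by
      rw [mul_sum, mul_sum, ← sum_sub_distrib]; exact sum_congr rfl fun u _ => by ring
    rw [this, hP1 t, mul_one]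
  have hft : f t - σ * ∑ u, P t u * f u = if t = t₀ then 1 else 0 := by rw [hf t]; ring
  rw [e1, e2, e3, ← hmN t]
  have e4 : (1 - σ) * m t * f t + σ / K * ((K : ℝ) * (m t * f t - m t * ∑ u, P t u * f u)) = m t * (f t - σ * ∑ u, P t u * f u) := by
    field_simp
    ring
  rw [e4, hft]
  by_cases htt : t = t₀
  · subst htt; simp
  · rw [if_neg htt, if_neg htt, mul_zero]

variable {a b : S} {PX PY : Option S → Option S → ℝ} {σ : ℝ}

/-- **DOMINATION OF COLUMN RESOLVENTS (Conjecture M, discounted form, every start):** for the tagged hub chains of `N_C + δ_a` (tag `a`) and `N_C + δ_b` (tag `b`) with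
`W_b ≤ W_a`, a present start `t₀` and the column resolvents `f_X = δ_{t₀} + σP_Xf_X`, `f_Y = δ_{t₀} + σP_Yf_Y` (`0 ≤ σ < 1`): at every present state `t`,
**`f_Y(t)/m_Y(t₀) ≤ f_X(t)/m_X(t₀)`**.  (The two networks differ only in the depth of ★, `1/W_a ≤ 1/W_b`; file 25.) [ours] -/
theorem tagged_column_domination (hW : ∀ v, 0 < W v) (hacc : ∀ h v, acc h v = min 1 (W h / W v)) (hK : 1 ≤ K) (hab : W b ≤ W a)
    (hPXoff : ∀ h v, h ≠ v → PX (some h) (some v) = if NC h = 0 then 0 else (NC v : ℝ) / K * acc h v)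
    (hPXin : ∀ h, PX (some h) none = if NC h = 0 then 0 else acc h a / K)
    (hPXdiag : ∀ h, PX (some h) (some h) = 1 - (∑ v ∈ univ.erase h, PX (some h) (some v) + PX (some h) none))
    (hPXout : ∀ v, PX none (some v) = (NC v : ℝ) / K * acc a v) (hPXstay : PX none none = 1 - ∑ v, PX none (some v))
    (hPYoff : ∀ h v, h ≠ v → PY (some h) (some v) = if NC h = 0 then 0 else (NC v : ℝ) / K * acc h v)
    (hPYin : ∀ h, PY (some h) none = if NC h = 0 then 0 else acc h b / K)
    (hPYdiag : ∀ h, PY (some h) (some h) = 1 - (∑ v ∈ univ.erase h, PY (some h) (some v) + PY (some h) none))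
    (hPYout : ∀ v, PY none (some v) = (NC v : ℝ) / K * acc b v) (hPYstay : PY none none = 1 - ∑ v, PY none (some v))
    (hσ0 : 0 ≤ σ) (hσ1 : σ < 1)
    {mX mY : Option S → ℝ} (hmXs : ∀ v, mX (some v) = (NC v : ℝ) / W v) (hmXn : mX none = 1 / W a)
    (hmYs : ∀ v, mY (some v) = (NC v : ℝ) / W v) (hmYn : mY none = 1 / W b)
    {t₀ : Option S} (ht₀ : Option.elim t₀ 1 NC ≠ 0) {fX fY : Option S → ℝ}
    (hfX : ∀ t, fX t = (if t = t₀ then 1 else 0) + σ * ∑ k, PX t k * fX k) (hfY : ∀ t, fY t = (if t = t₀ then 1 else 0) + σ * ∑ k, PY t k * fY k) :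
    ∀ t, Option.elim t 1 NC ≠ 0 → fY t / mY t₀ ≤ fX t / mX t₀ := by
  classical
  -- weights, depths, the present set, the operator
  set N : Option S → ℝ := fun t => ((Option.elim t 1 NC : ℕ) : ℝ) with hN
  set ρX : Option S → ℝ := fun t => Option.elim t (1 / W a) (fun v => 1 / W v) with hρX
  set ρY : Option S → ℝ := fun t => Option.elim t (1 / W b) (fun v => 1 / W v) with hρY
  set A : Finset (Option S) := univ.filter (fun t => Option.elim t 1 NC ≠ 0) with hAdef
  have hA : ∀ t, t ∈ A ↔ N t ≠ 0 := fun t => by simp [hAdef, hN]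
  set L : Finset (Option S) → (Option S → ℝ) → (Option S → ℝ) → Option S → ℝ :=
    fun A ρ φ v => (1 - σ) * (N v * ρ v) * φ v + σ / K * ∑ u ∈ A.erase v, N u * N v * min (ρ u) (ρ v) * (φ v - φ u) with hLdef
  have hL : ∀ A ρ φ v, L A ρ φ v = (1 - σ) * (N v * ρ v) * φ v + σ / K * ∑ u ∈ A.erase v, N u * N v * min (ρ u) (ρ v) * (φ v - φ u) :=
    fun _ _ _ _ => rfl
  -- both column resolvents solve the system, with sources `m_X(t₀)δ`, `m_Y(t₀)δ`
  have hsX := tagged_column_minNet hW hacc hPXoff hPXin hPXdiag hPXout hPXstay hK hmXs hmXn (N := N) (fun v => by simp [hN]) (by simp [hN])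
    (ρ := ρX) (fun v => by simp [hρX]) (by simp [hρX]) hfX hL hA
  have hsY := tagged_column_minNet hW hacc hPYoff hPYin hPYdiag hPYout hPYstay hK hmYs hmYn (N := N) (fun v => by simp [hN]) (by simp [hN])
    (ρ := ρY) (fun v => by simp [hρY]) (by simp [hρY]) hfY hL hA
  -- positivity of the start masses
  have hmX0 : 0 < mX t₀ := by
    rcases t₀ with _ | z
    · rw [hmXn]; exact one_div_pos.mpr (hW a)
    · rw [hmXs]; simp at ht₀; exact div_pos (by exact_mod_cast Nat.pos_of_ne_zero ht₀) (hW z)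
  have hmY0 : 0 < mY t₀ := by
    rcases t₀ with _ | z
    · rw [hmYn]; exact one_div_pos.mpr (hW b)
    · rw [hmYs]; simp at ht₀; exact div_pos (by exact_mod_cast Nat.pos_of_ne_zero ht₀) (hW z)
  -- normalise to the common source `δ_{t₀}`
  have hφX : ∀ t ∈ A, L A ρX (fun u => 1 / mX t₀ * fX u) t = if t = t₀ then 1 else 0 := by
    intro t ht
    rw [minNet_smul hL, hsX t ht]
    by_cases htt : t = t₀
    · rw [if_pos htt, if_pos htt]; field_simp
    · rw [if_neg htt, if_neg htt, mul_zero]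
  have hφY : ∀ t ∈ A, L A ρY (fun u => 1 / mY t₀ * fY u) t = if t = t₀ then 1 else 0 := by
    intro t ht
    rw [minNet_smul hL, hsY t ht]
    by_cases htt : t = t₀
    · rw [if_pos htt, if_pos htt]; field_simp
    · rw [if_neg htt, if_neg htt, mul_zero]
  -- hypotheses of the comparison theorem
  have h1σ : 0 < 1 - σ := by linarith
  have hβ : 0 ≤ σ / K := div_nonneg hσ0 (Nat.cast_nonneg _)
  have hNpos : ∀ t ∈ A, 0 < N t := fun t ht => lt_of_le_of_ne (by simp [hN]) (Ne.symm ((hA t).mp ht))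
  have hρpos : ∀ t ∈ A, 0 < ρX t := by
    intro t _; rcases t with _ | v
    · simp [hρX]; exact hW a
    · simp [hρX]; exact hW v
  have hρle : ∀ t ∈ A, ρX t ≤ ρY t := by
    intro t _; rcases t with _ | v
    · simp only [hρX, hρY, Option.elim]; exact one_div_le_one_div_of_le (hW b) hab
    · simp [hρX, hρY]
  have hsrc : ∀ t ∈ A, (0 : ℝ) ≤ if t = t₀ then 1 else 0 := fun t _ => by split_ifs <;> norm_num
  have hmono := minNet_antitone hL h1σ hβ A.card A rfl hNpos ρX ρY (fun t => if t = t₀ then (1 : ℝ) else 0)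
    (fun u => 1 / mX t₀ * fX u) (fun u => 1 / mY t₀ * fY u) hρpos hρle hsrc hφX hφY
  intro t ht
  have htA : t ∈ A := by rw [hAdef, mem_filter]; exact ⟨mem_univ _, ht⟩
  have h := hmono t htA
  rw [div_eq_inv_mul, div_eq_inv_mul, ← one_div, ← one_div]
  exact h

/-- The tagged tail resolvent from ★ gives no mass to absent contents. [ours] -/
theorem tagged_star_tail_absent (hW : ∀ v, 0 < W v) (hacc : ∀ h v, acc h v = min 1 (W h / W v))
    (hPoff : ∀ h v, h ≠ v → P (some h) (some v) = if NC h = 0 then 0 else (NC v : ℝ) / K * acc h v)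
    (hPin : ∀ h, P (some h) none = if NC h = 0 then 0 else acc h s / K)
    (hPdiag : ∀ h, P (some h) (some h) = 1 - (∑ v ∈ univ.erase h, P (some h) (some v) + P (some h) none))
    (hPout : ∀ v, P none (some v) = (NC v : ℝ) / K * acc s v) (hPstay : P none none = 1 - ∑ v, P none (some v))
    (hK : 1 ≤ K) (hNC : ∑ v, NC v = K) (hσ0 : 0 ≤ σ) (hσ1 : σ < 1)
    {us : Option S → ℝ} (hus : ∀ t, us t = (1 - σ) * P none t + σ * ∑ t', us t' * P t' t) {w : S} (hw : NC w = 0) : us (some w) = 0 := by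
  classical
  have hP0 := tagged_nonneg hW hacc hPoff hPin hPdiag hPout hPstay hK hNC
  have hP1 := tagged_rowsum (P := P) hPdiag hPstay
  refine geomResolvent_support_subset hP0 hP1 hσ0 hσ1 (ν := fun t => P none t) hus (fun t => t = none ∨ ∃ v, t = some v ∧ NC v ≠ 0)
    (fun t ht => ?_) (fun t' t hG hnG => ?_) (some w)
    (by
      rintro (h | ⟨v, hv, hne⟩)
      · exact Option.some_ne_none w h
      · exact hne ((Option.some_inj.mp hv) ▸ hw))
  · rcases t with _ | v
    · exact absurd (Or.inl rfl) ht
    · have hv : NC v = 0 := by by_contra h; exact ht (Or.inr ⟨v, rfl, h⟩)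
      exact (tagged_absent_col hPoff hPout hv).1
  · rcases t with _ | v
    · exact absurd (Or.inl rfl) hnG
    · have hv : NC v = 0 := by by_contra h; exact hnG (Or.inr ⟨v, rfl, h⟩)
      rcases t' with _ | h
      · exact (tagged_absent_col hPoff hPout hv).1
      · have hh : NC h ≠ 0 := by
          rcases hG with h0 | ⟨v', hv', hne⟩
          · exact absurd h0 (Option.some_ne_none h)
          · exact (Option.some_inj.mp hv') ▸ hne
        exact (tagged_absent_col hPoff hPout hv).2 h (fun e => hh (e ▸ hv))

/-- **DOMINATION FROM THE HUB (hypothesis `hdom` of file 23, Conjecture M′ ∕ D of MEMO-gen37):** for the tagged hub chains of `N_C + δ_a` (tag `a`) and `N_C + δ_b` (tag `b`) with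
`W_b ≤ W_a` and a common present ordinary start `z`, the tail laws at any odds `σ ∈ [0,1)` satisfy **`ỹ(w) ≤ x̃(w)` for every ordinary content `w`**. [ours] -/
theorem tagged_hub_domination (hW : ∀ v, 0 < W v) (hacc : ∀ h v, acc h v = min 1 (W h / W v)) (hK : 1 ≤ K) (hNC : ∑ v, NC v = K) (hab : W b ≤ W a)
    (hPXoff : ∀ h v, h ≠ v → PX (some h) (some v) = if NC h = 0 then 0 else (NC v : ℝ) / K * acc h v)
    (hPXin : ∀ h, PX (some h) none = if NC h = 0 then 0 else acc h a / K)
    (hPXdiag : ∀ h, PX (some h) (some h) = 1 - (∑ v ∈ univ.erase h, PX (some h) (some v) + PX (some h) none))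
    (hPXout : ∀ v, PX none (some v) = (NC v : ℝ) / K * acc a v) (hPXstay : PX none none = 1 - ∑ v, PX none (some v))
    (hPYoff : ∀ h v, h ≠ v → PY (some h) (some v) = if NC h = 0 then 0 else (NC v : ℝ) / K * acc h v)
    (hPYin : ∀ h, PY (some h) none = if NC h = 0 then 0 else acc h b / K)
    (hPYdiag : ∀ h, PY (some h) (some h) = 1 - (∑ v ∈ univ.erase h, PY (some h) (some v) + PY (some h) none))
    (hPYout : ∀ v, PY none (some v) = (NC v : ℝ) / K * acc b v) (hPYstay : PY none none = 1 - ∑ v, PY none (some v))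
    (hσ0 : 0 ≤ σ) (hσ1 : σ < 1) {z : S} (hz : NC z ≠ 0) {xt yt : Option S → ℝ}
    (hxt : ∀ t, xt t = (1 - σ) * PX (some z) t + σ * ∑ t', xt t' * PX t' t) (hyt : ∀ t, yt t = (1 - σ) * PY (some z) t + σ * ∑ t', yt t' * PY t' t) :
    ∀ w, yt (some w) ≤ xt (some w) := by
  classical
  intro w
  by_cases hw : NC w = 0
  · rw [tagged_tail_absent hW hacc hPXoff hPXin hPXdiag hPXout hPXstay hK hNC hσ0 hσ1 hz hxt hw,
      tagged_tail_absent hW hacc hPYoff hPYin hPYdiag hPYout hPYstay hK hNC hσ0 hσ1 hz hyt hw]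
  rcases eq_or_lt_of_le hσ0 with hσ | hσpos
  · -- `σ = 0`: one step
    subst hσ
    have ex : xt (some w) = PX (some z) (some w) := by rw [hxt]; simp
    have ey : yt (some w) = PY (some z) (some w) := by rw [hyt]; simp
    rw [ex, ey]
    by_cases hzw : z = w
    · subst hzw
      rw [hPXdiag, hPYdiag, hPXin, hPYin, if_neg hz, if_neg hz]
      have hoff : ∑ v ∈ univ.erase z, PX (some z) (some v) = ∑ v ∈ univ.erase z, PY (some z) (some v) :=
        sum_congr rfl fun v hv => by rw [hPXoff z v (ne_of_mem_erase hv).symm, hPYoff z v (ne_of_mem_erase hv).symm]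
      have hacc_le : acc z a ≤ acc z b := by
        rw [hacc, hacc]; exact min_le_min le_rfl (div_le_div_of_nonneg_left (hW z).le (hW b) hab)
      have hK0 : (0 : ℝ) < K := by exact_mod_cast hK
      have := div_le_div_of_nonneg_right hacc_le hK0.le
      linarith
    · rw [hPXoff z w hzw, hPYoff z w hzw]
  · -- `σ > 0`: column resolvents and the comparison theorem
    set mX : Option S → ℝ := fun t => Option.elim t (1 / W a) (fun v => (NC v : ℝ) / W v) with hmX
    set mY : Option S → ℝ := fun t => Option.elim t (1 / W b) (fun v => (NC v : ℝ) / W v) with hmY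
    have hrevX := tagged_detailedBalance hW hacc hPXoff hPXin hPXout (m := mX) (fun v => by simp [hmX]) (by simp [hmX])
    have hrevY := tagged_detailedBalance hW hacc hPYoff hPYin hPYout (m := mY) (fun v => by simp [hmY]) (by simp [hmY])
    have hm0X : ∀ t, 0 ≤ mX t := tagged_mass_nonneg (NC := NC) (s := a) hW
    have hm0Y : ∀ t, 0 ≤ mY t := tagged_mass_nonneg (NC := NC) (s := b) hW
    have hmz : 0 < mX (some z) := by simp [hmX]; exact div_pos (by exact_mod_cast Nat.pos_of_ne_zero hz) (hW z)
    have hmz' : 0 < mY (some z) := by simp [hmY]; exact div_pos (by exact_mod_cast Nat.pos_of_ne_zero hz) (hW z)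
    have hnullX : ∀ t k, mX t = 0 → mX k ≠ 0 → PX t k = 0 := tagged_null_row (s := a) hW hPXoff hPXin
    have hnullY : ∀ t k, mY t = 0 → mY k ≠ 0 → PY t k = 0 := tagged_null_row (s := b) hW hPYoff hPYin
    set fX : Option S → ℝ := fun t => mX (some z) * ((1 - σ) * (if t = some z then 1 else 0) + σ * xt t) / ((1 - σ) * mX t) with hfX
    set fY : Option S → ℝ := fun t => mY (some z) * ((1 - σ) * (if t = some z then 1 else 0) + σ * yt t) / ((1 - σ) * mY t) with hfY
    have hfXeq := rowResolvent_to_column hrevX hσ1 hmz hm0X hnullX hxt (f := fX) (fun t => rfl)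
    have hfYeq := rowResolvent_to_column hrevY hσ1 hmz' hm0Y hnullY hyt (f := fY) (fun t => rfl)
    have hdom := tagged_column_domination hW hacc hK hab hPXoff hPXin hPXdiag hPXout hPXstay hPYoff hPYin hPYdiag hPYout hPYstay hσ0 hσ1
      (mX := mX) (mY := mY) (fun v => by simp [hmX]) (by simp [hmX]) (fun v => by simp [hmY]) (by simp [hmY])
      (t₀ := some z) (by simpa using hz) hfXeq hfYeq (some w) (by simpa using hw)
    -- unfold the two sides at `some w`
    have h1σ : 0 < 1 - σ := by linarith
    have hmw : 0 < mX (some w) := by simp [hmX]; exact div_pos (by exact_mod_cast Nat.pos_of_ne_zero hw) (hW w)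
    have hmwY : mY (some w) = mX (some w) := by simp [hmX, hmY]
    have hmzY : mY (some z) = mX (some z) := by simp [hmX, hmY]
    have eX : fX (some w) / mX (some z) = ((1 - σ) * (if some w = some z then (1 : ℝ) else 0) + σ * xt (some w)) / ((1 - σ) * mX (some w)) := by
      simp only [hfX]; field_simp
    have eY : fY (some w) / mY (some z) = ((1 - σ) * (if some w = some z then (1 : ℝ) else 0) + σ * yt (some w)) / ((1 - σ) * mX (some w)) := by
      simp only [hfY]; rw [hmwY, hmzY]; field_simp
    rw [eX, eY, div_le_div_iff_of_pos_right (mul_pos h1σ hmw)] at hdom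
    nlinarith

/-- **DOMINATION FROM ★ (hypothesis `hDstar` of file 23, Conjecture M★ of MEMO-gen37):** for the same two tagged chains and the tail laws from the start ★,
**`ỹ_★(w) ≤ x̃_★(w)` for every ordinary content `w`**. [ours] -/
theorem tagged_star_domination (hW : ∀ v, 0 < W v) (hacc : ∀ h v, acc h v = min 1 (W h / W v)) (hK : 1 ≤ K) (hNC : ∑ v, NC v = K) (hab : W b ≤ W a)
    (hPXoff : ∀ h v, h ≠ v → PX (some h) (some v) = if NC h = 0 then 0 else (NC v : ℝ) / K * acc h v)
    (hPXin : ∀ h, PX (some h) none = if NC h = 0 then 0 else acc h a / K)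
    (hPXdiag : ∀ h, PX (some h) (some h) = 1 - (∑ v ∈ univ.erase h, PX (some h) (some v) + PX (some h) none))
    (hPXout : ∀ v, PX none (some v) = (NC v : ℝ) / K * acc a v) (hPXstay : PX none none = 1 - ∑ v, PX none (some v))
    (hPYoff : ∀ h v, h ≠ v → PY (some h) (some v) = if NC h = 0 then 0 else (NC v : ℝ) / K * acc h v)
    (hPYin : ∀ h, PY (some h) none = if NC h = 0 then 0 else acc h b / K)
    (hPYdiag : ∀ h, PY (some h) (some h) = 1 - (∑ v ∈ univ.erase h, PY (some h) (some v) + PY (some h) none))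
    (hPYout : ∀ v, PY none (some v) = (NC v : ℝ) / K * acc b v) (hPYstay : PY none none = 1 - ∑ v, PY none (some v))
    (hσ0 : 0 ≤ σ) (hσ1 : σ < 1) {xs ys : Option S → ℝ}
    (hxs : ∀ t, xs t = (1 - σ) * PX none t + σ * ∑ t', xs t' * PX t' t) (hys : ∀ t, ys t = (1 - σ) * PY none t + σ * ∑ t', ys t' * PY t' t) :
    ∀ w, ys (some w) ≤ xs (some w) := by
  classical
  intro w
  by_cases hw : NC w = 0
  · rw [tagged_star_tail_absent hW hacc hPXoff hPXin hPXdiag hPXout hPXstay hK hNC hσ0 hσ1 hxs hw,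
      tagged_star_tail_absent hW hacc hPYoff hPYin hPYdiag hPYout hPYstay hK hNC hσ0 hσ1 hys hw]
  rcases eq_or_lt_of_le hσ0 with hσ | hσpos
  · -- `σ = 0`: one step, `acc(b,w) ≤ acc(a,w)`
    subst hσ
    have ex : xs (some w) = PX none (some w) := by rw [hxs]; simp
    have ey : ys (some w) = PY none (some w) := by rw [hys]; simp
    rw [ex, ey, hPXout, hPYout]
    have hacc_le : acc b w ≤ acc a w := by
      rw [hacc, hacc]; exact min_le_min le_rfl (div_le_div_of_nonneg_right hab (hW w).le)
    have hK0 : (0 : ℝ) < K := by exact_mod_cast hK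
    exact mul_le_mul_of_nonneg_left hacc_le (div_nonneg (Nat.cast_nonneg _) hK0.le)
  · set mX : Option S → ℝ := fun t => Option.elim t (1 / W a) (fun v => (NC v : ℝ) / W v) with hmX
    set mY : Option S → ℝ := fun t => Option.elim t (1 / W b) (fun v => (NC v : ℝ) / W v) with hmY
    have hrevX := tagged_detailedBalance hW hacc hPXoff hPXin hPXout (m := mX) (fun v => by simp [hmX]) (by simp [hmX])
    have hrevY := tagged_detailedBalance hW hacc hPYoff hPYin hPYout (m := mY) (fun v => by simp [hmY]) (by simp [hmY])
    have hm0X : ∀ t, 0 ≤ mX t := tagged_mass_nonneg (NC := NC) (s := a) hW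
    have hm0Y : ∀ t, 0 ≤ mY t := tagged_mass_nonneg (NC := NC) (s := b) hW
    have hmn : 0 < mX none := by simp [hmX]; exact hW a
    have hmn' : 0 < mY none := by simp [hmY]; exact hW b
    have hnullX : ∀ t k, mX t = 0 → mX k ≠ 0 → PX t k = 0 := tagged_null_row (s := a) hW hPXoff hPXin
    have hnullY : ∀ t k, mY t = 0 → mY k ≠ 0 → PY t k = 0 := tagged_null_row (s := b) hW hPYoff hPYin
    set fX : Option S → ℝ := fun t => mX none * ((1 - σ) * (if t = none then 1 else 0) + σ * xs t) / ((1 - σ) * mX t) with hfX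
    set fY : Option S → ℝ := fun t => mY none * ((1 - σ) * (if t = none then 1 else 0) + σ * ys t) / ((1 - σ) * mY t) with hfY
    have hfXeq := rowResolvent_to_column hrevX hσ1 hmn hm0X hnullX hxs (f := fX) (fun t => rfl)
    have hfYeq := rowResolvent_to_column hrevY hσ1 hmn' hm0Y hnullY hys (f := fY) (fun t => rfl)
    have hdom := tagged_column_domination hW hacc hK hab hPXoff hPXin hPXdiag hPXout hPXstay hPYoff hPYin hPYdiag hPYout hPYstay hσ0 hσ1
      (mX := mX) (mY := mY) (fun v => by simp [hmX]) (by simp [hmX]) (fun v => by simp [hmY]) (by simp [hmY])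
      (t₀ := none) (by simp) hfXeq hfYeq (some w) (by simpa using hw)
    have h1σ : 0 < 1 - σ := by linarith
    have hmw : 0 < mX (some w) := by simp [hmX]; exact div_pos (by exact_mod_cast Nat.pos_of_ne_zero hw) (hW w)
    have hmwY : mY (some w) = mX (some w) := by simp [hmX, hmY]
    have eX : fX (some w) / mX none = (σ * xs (some w)) / ((1 - σ) * mX (some w)) := by
      simp only [hfX]; field_simp; simp
    have eY : fY (some w) / mY none = (σ * ys (some w)) / ((1 - σ) * mX (some w)) := by
      simp only [hfY]; rw [hmwY]; field_simp; simp
    rw [eX, eY, div_le_div_iff_of_pos_right (mul_pos h1σ hmw)] at hdom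
    nlinarith

end TaggedNet

end Summit.Ventures.LatticeQCDFlow.Scaling
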